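import Mathlib
import HarnessLib
import Literature.Analysis.FluidPDE.SelfSimilar
import Literature.Analysis.FluidPDE.TaoEnstrophyLocalisation
import Summits.NavierStokesRegularity.NavierStokesRegularity.Theorems.AxisTwistDoorAveragedConeLiouvilleDefs
import Summits.NavierStokesRegularity.NavierStokesRegularity.Theorems.AxisTwistDoorAveragedConeLiouvilleCircleStokes
import Summits.NavierStokesRegularity.NavierStokesRegularity.Theorems.AxisTwistDoorAveragedConeLiouvilleCylFrame
import Summits.NavierStokesRegularity.NavierStokesRegularity.Theorems.LerayQuarterDissipationFiniteDissipationLiouvilleQuietVorticity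

/-!
# Route `AxisTwistDoor`, crux `AveragedConeLiouville` (stmt-NavierStokesRegularity-26889), line `lrt_shell` —
# brick Z3 toward stub (6) `stub_regularOfFluxDecay` (and stub (0)): the circle functionals under RESCALING and under
# LOCALLY UNIFORM LIMITS

Bookkeeping for the second-zoom route to stub (6) (census `CENSUS-26889-stub6.md` on the crux item; rigidity brick
`…FlatFlux`): how the circle functionals of `AxisTwistDoorAveragedConeLiouvilleDefs` behave

* under the parabolic rescaling `nsRescale c u (t, x) = c • u (c² t) (c • x)` (`Literature…SelfSimilar`): the axis
  circulation is SCALE INVARIANT, `circ (nsRescale c u) r z s = circ u (c r) (c z) (c² s)` (`circ_nsRescale`), while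
  `vortCirc` and `tiltCirc` pick up the factor `c` (`vortCirc_nsRescale`, `tiltCirc_nsRescale`); hence `SignE3` and
  `GlobalCone` (same constant) are inherited by rescalings with `c > 0` (`signE3_nsRescale`, `globalCone_nsRescale`), and
  `FluxDecay u` makes `circ (nsRescale (c k) u) r z s → 0` along `c k → 0⁺` at every point of the open lower slab
  (`tendsto_circ_nsRescale_of_fluxDecay`);
* under locally uniform convergence of slices (resp. of slice gradients, as delivered by the class compactness theorem
  `exists_tendsto_of_isTypeIAncientMild_seq`): `circ` (resp. `vortCirc`, `tiltCirc`) converge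
  (`tendsto_circ`, `tendsto_vortCirc`, `tendsto_tiltCirc`, from the generic `tendsto_circleIntegral`), so the sign
  `ω₃ ≥ 0`, the circle cone and the vanishing of `Γ` pass to the limit (`inner_curl_e3_nonneg_of_tendsto`,
  `tiltCirc_le_of_tendsto`, `circ_eq_zero_of_tendsto`).

WHAT THIS IS NOT: calculus/bookkeeping about circle integrals of hypothetical profiles; nothing about Navier–Stokes
regularity (Clay A) is proved or claimed; `--supports` stmt-…-26889 only, no item is closed.
-/

noncomputable section

-- the summit and its single sub-problem share the name (CONVENTIONS §1), as in every Theorems file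
set_option linter.dupNamespace false

namespace Summit.NavierStokesRegularity.NavierStokesRegularity.Theorems.AveragedConeLiouville.CircleLimits

open scoped Topology InnerProductSpace
open Set Function MeasureTheory intervalIntegral Filter Metric
open Literature.Analysis
open Literature.Analysis.FluidPDE hiding eR
open Summit.NavierStokesRegularity.NavierStokesRegularity.Theorems.AxisTwistDoorAveragedConeLiouvilleDefs
open Summit.NavierStokesRegularity.NavierStokesRegularity.Theorems.AveragedConeLiouville.CircleStokes
open Summit.NavierStokesRegularity.NavierStokesRegularity.Theorems.AxisTwistDoorAveragedConeLiouvilleCylFrame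
open Summit.NavierStokesRegularity.NavierStokesRegularity.Theorems.FiniteDissipationLiouville.QuietVorticity (curl_nsRescale)

/-! ### Rescaling covariance -/

/-- `c • cylPt r θ z = cylPt (c r) θ (c z)`. -/
theorem smul_cylPt (c r θ z : ℝ) : c • cylPt r θ z = cylPt (c * r) θ (c * z) := by
  ext i
  fin_cases i <;> simp [cylPt] <;> ring

/-- **The axis circulation is scale invariant**: `circ (nsRescale c u) r z s = circ u (c r) (c z) (c² s)`. -/
theorem circ_nsRescale (c : ℝ) (u : ℝ → EuclideanSpace ℝ (Fin 3) → EuclideanSpace ℝ (Fin 3)) (r z s : ℝ) :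
    circ (nsRescale c u) r z s = circ u (c * r) (c * z) (c ^ 2 * s) := by
  unfold circ
  refine intervalIntegral.integral_congr fun θ _ => ?_
  simp only [nsRescale, smul_cylPt, inner_smul_left, RCLike.conj_to_real]
  ring

/-- `vortCirc (nsRescale c u) r z s = c · vortCirc u (c r) (c z) (c² s)`. -/
theorem vortCirc_nsRescale (c : ℝ) (u : ℝ → EuclideanSpace ℝ (Fin 3) → EuclideanSpace ℝ (Fin 3)) (r z s : ℝ) :
    vortCirc (nsRescale c u) r z s = c * vortCirc u (c * r) (c * z) (c ^ 2 * s) := by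
  unfold vortCirc
  rw [← intervalIntegral.integral_const_mul]
  refine intervalIntegral.integral_congr fun θ _ => ?_
  simp only [curl_nsRescale, smul_cylPt, inner_smul_left, RCLike.conj_to_real]
  ring

/-- `tiltCirc (nsRescale c u) r z s = c · tiltCirc u (c r) (c z) (c² s)` (the factor `c·c ≥ 0` leaves the norm). -/
theorem tiltCirc_nsRescale (c : ℝ) (u : ℝ → EuclideanSpace ℝ (Fin 3) → EuclideanSpace ℝ (Fin 3)) (r z s : ℝ) :
    tiltCirc (nsRescale c u) r z s = c * tiltCirc u (c * r) (c * z) (c ^ 2 * s) := by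
  unfold tiltCirc
  rw [← intervalIntegral.integral_const_mul]
  refine intervalIntegral.integral_congr fun θ _ => ?_
  simp only [curl_nsRescale, smul_cylPt, inner_smul_left, RCLike.conj_to_real]
  rw [show (c * c) • curl (u (c ^ 2 * s)) (cylPt (c * r) θ (c * z))
        - (c * c * ⟪curl (u (c ^ 2 * s)) (cylPt (c * r) θ (c * z)), e3⟫_ℝ) • e3
      = (c * c) • (curl (u (c ^ 2 * s)) (cylPt (c * r) θ (c * z))
        - ⟪curl (u (c ^ 2 * s)) (cylPt (c * r) θ (c * z)), e3⟫_ℝ • e3) by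
      rw [smul_sub, smul_smul],
    norm_smul, Real.norm_eq_abs, abs_of_nonneg (mul_self_nonneg c)]
  ring

/-- `SignE3` is inherited by rescalings with `c > 0`. -/
theorem signE3_nsRescale {u : ℝ → EuclideanSpace ℝ (Fin 3) → EuclideanSpace ℝ (Fin 3)} (h : SignE3 u) {c : ℝ}
    (hc : 0 < c) : SignE3 (nsRescale c u) := by
  intro s hs y
  have hcs : c ^ 2 * s < 0 := mul_neg_of_pos_of_neg (pow_pos hc 2) hs
  rw [curl_nsRescale, inner_smul_left, RCLike.conj_to_real]
  exact mul_nonneg (mul_self_nonneg c) (h _ hcs _)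

/-- `GlobalCone` (with the same constant) is inherited by rescalings with `c > 0`. -/
theorem globalCone_nsRescale {u : ℝ → EuclideanSpace ℝ (Fin 3) → EuclideanSpace ℝ (Fin 3)} (h : GlobalCone u)
    {c : ℝ} (hc : 0 < c) : GlobalCone (nsRescale c u) := by
  obtain ⟨K, hK0, hK⟩ := h
  refine ⟨K, hK0, fun s hs r hr z => ?_⟩
  have hcs : c ^ 2 * s < 0 := mul_neg_of_pos_of_neg (pow_pos hc 2) hs
  have h1 : tiltCirc u (c * r) (c * z) (c ^ 2 * s) ≤ K * vortCirc u (c * r) (c * z) (c ^ 2 * s) :=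
    hK _ hcs _ (mul_pos hc hr) _
  show tiltCirc (nsRescale c u) r z s ≤ K * vortCirc (nsRescale c u) r z s
  rw [tiltCirc_nsRescale, vortCirc_nsRescale]
  nlinarith [h1, hc]

/-- **`FluxDecay` in the zoom**: along scales `c k → 0⁺`, the axis circulation of the rescalings tends to zero at every
point `(r, z, s)` with `r > 0`, `s < 0`, provided it is non-negative there (e.g. under `ω₃ ≥ 0`,
`…CircMonotone.circ_nonneg`). -/
theorem tendsto_circ_nsRescale_of_fluxDecay {u : ℝ → EuclideanSpace ℝ (Fin 3) → EuclideanSpace ℝ (Fin 3)}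
    (h : FluxDecay u) (hnn : ∀ s < 0, ∀ r, 0 < r → ∀ z, 0 ≤ circ u r z s)
    {c : ℕ → ℝ} (hc : ∀ k, 0 < c k) (hc0 : Tendsto c atTop (𝓝 0))
    {r z s : ℝ} (hr : 0 < r) (hs : s < 0) :
    Tendsto (fun k => circ (nsRescale (c k) u) r z s) atTop (𝓝 0) := by
  rw [Metric.tendsto_atTop]
  intro κ hκ
  obtain ⟨ρ, hρ, hρκ⟩ := h κ hκ
  -- eventually `c k · max (r, |z|, √(-s)) < ρ`
  set m : ℝ := max r (max |z| (Real.sqrt (-s))) + 1 with hm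
  have hm0 : 0 < m := by have := le_max_left r (max |z| (Real.sqrt (-s))); linarith
  have hev : ∀ᶠ k in atTop, c k < ρ / m := by
    have : Iio (ρ / m) ∈ 𝓝 (0 : ℝ) := Iio_mem_nhds (div_pos hρ hm0)
    exact hc0.eventually this
  obtain ⟨N, hN⟩ := eventually_atTop.1 hev
  refine ⟨N, fun k hk => ?_⟩
  have hck : c k < ρ / m := hN k hk
  have hck' : c k * m < ρ := by rwa [lt_div_iff₀ hm0] at hck
  have hr_le : r ≤ m := by simp only [hm]; linarith [le_max_left r (max |z| (Real.sqrt (-s)))]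
  have hz_le : |z| ≤ m := by
    simp only [hm]
    linarith [le_max_right r (max |z| (Real.sqrt (-s))), le_max_left |z| (Real.sqrt (-s))]
  have hs_le : Real.sqrt (-s) ≤ m := by
    simp only [hm]
    linarith [le_max_right r (max |z| (Real.sqrt (-s))), le_max_right |z| (Real.sqrt (-s))]
  have hck0 := hc k
  have h1 : c k * r < ρ := lt_of_le_of_lt (mul_le_mul_of_nonneg_left hr_le hck0.le) hck'
  have h2 : |c k * z| < ρ := by
    rw [abs_mul, abs_of_pos hck0]
    exact lt_of_le_of_lt (mul_le_mul_of_nonneg_left hz_le hck0.le) hck'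
  have h3 : -ρ ^ 2 < c k ^ 2 * s := by
    have hsq : c k * Real.sqrt (-s) < ρ := lt_of_le_of_lt (mul_le_mul_of_nonneg_left hs_le hck0.le) hck'
    have h0 : 0 ≤ c k * Real.sqrt (-s) := mul_nonneg hck0.le (Real.sqrt_nonneg _)
    have hss : (c k * Real.sqrt (-s)) ^ 2 = -(c k ^ 2 * s) := by
      rw [mul_pow, Real.sq_sqrt (by linarith)]; ring
    nlinarith [hsq, h0, hss, hρ]
  have hcs : c k ^ 2 * s < 0 := mul_neg_of_pos_of_neg (pow_pos hck0 2) hs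
  have hlt := hρκ (c k ^ 2 * s) (c k * r) (c k * z) h3 hcs (mul_pos hck0 hr) h1 h2
  have hge := hnn _ hcs _ (mul_pos hck0 hr) (c k * z)
  rw [Real.dist_eq, circ_nsRescale, sub_zero, abs_of_nonneg hge]
  exact hlt

/-! ### Circle functionals under locally uniform convergence -/

/-- The circle `θ ↦ cylPt r θ z` stays in the closed ball of radius `|r| + |z|`. -/
theorem norm_cylPt_le (r θ z : ℝ) : ‖cylPt r θ z‖ ≤ |r| + |z| := by
  rw [cylPt_eq_smul_eR]
  refine (norm_add_le _ _).trans ?_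
  rw [norm_smul, norm_smul, norm_eR, Real.norm_eq_abs, Real.norm_eq_abs, mul_one]
  have : ‖e3‖ = 1 := by simp [e3]
  rw [this, mul_one]

variable {F : ℕ → EuclideanSpace ℝ (Fin 3) → EuclideanSpace ℝ (Fin 3)} {G : EuclideanSpace ℝ (Fin 3) → EuclideanSpace ℝ (Fin 3)}

/-- **Generic limit of circle integrals**: if `F j → G` locally uniformly (all continuous) and the integrand `Φ θ a` is
jointly continuous and `L`-Lipschitz in `a`, then `∫₀^{2π} Φ θ (F j (cylPt r θ z)) dθ → ∫₀^{2π} Φ θ (G (cylPt r θ z)) dθ`. -/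
theorem tendsto_circleIntegral (hF : ∀ j, Continuous (F j)) (hG : Continuous G)
    (h : TendstoLocallyUniformly F G atTop) {Φ : ℝ → EuclideanSpace ℝ (Fin 3) → ℝ}
    (hΦ : Continuous (uncurry Φ)) {L : ℝ} (hL0 : 0 ≤ L)
    (hL : ∀ θ a b, |Φ θ a - Φ θ b| ≤ L * ‖a - b‖) (r z : ℝ) :
    Tendsto (fun j => ∫ θ in (0 : ℝ)..(2 * Real.pi), Φ θ (F j (cylPt r θ z))) atTop
      (𝓝 (∫ θ in (0 : ℝ)..(2 * Real.pi), Φ θ (G (cylPt r θ z)))) := by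
  have hp := continuous_cylPt_θ r z
  -- uniform convergence on the compact ball containing the circle
  set K : Set (EuclideanSpace ℝ (Fin 3)) := closedBall 0 (|r| + |z|) with hK
  have hKc : IsCompact K := isCompact_closedBall _ _
  have hU : TendstoUniformlyOn F G atTop K :=
    (tendstoLocallyUniformlyOn_iff_tendstoUniformlyOn_of_compact hKc).1
      ((tendstoLocallyUniformlyOn_univ.2 h).mono (subset_univ K))
  have hmem : ∀ θ : ℝ, cylPt r θ z ∈ K := fun θ => by
    rw [hK, mem_closedBall, dist_zero_right]; exact norm_cylPt_le r θ z
  -- continuity (hence integrability) of the integrands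
  have hcj : ∀ j, Continuous fun θ => Φ θ (F j (cylPt r θ z)) := fun j =>
    hΦ.comp (continuous_id.prodMk ((hF j).comp hp))
  have hcG : Continuous fun θ => Φ θ (G (cylPt r θ z)) := hΦ.comp (continuous_id.prodMk (hG.comp hp))
  rw [Metric.tendsto_atTop]
  intro ε hε
  set δ : ℝ := ε / (2 * Real.pi * (L + 1) + 1) with hδ
  have hden : 0 < 2 * Real.pi * (L + 1) + 1 := by positivity
  have hδ0 : 0 < δ := div_pos hε hden
  obtain ⟨N, hN⟩ := eventually_atTop.1 ((Metric.tendstoUniformlyOn_iff.1 hU) δ hδ0)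
  refine ⟨N, fun j hj => ?_⟩
  have hpt : ∀ θ ∈ Set.uIoc (0 : ℝ) (2 * Real.pi),
      ‖Φ θ (F j (cylPt r θ z)) - Φ θ (G (cylPt r θ z))‖ ≤ L * δ := fun θ _ => by
    rw [Real.norm_eq_abs]
    refine (hL θ _ _).trans (mul_le_mul_of_nonneg_left ?_ hL0)
    have hd := hN j hj (cylPt r θ z) (hmem θ)
    rw [dist_eq_norm'] at hd
    exact hd.le
  have hI := intervalIntegral.norm_integral_le_of_norm_le_const hpt
  rw [Real.dist_eq, ← intervalIntegral.integral_sub ((hcj j).intervalIntegrable _ _) (hcG.intervalIntegrable _ _)]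
  refine lt_of_le_of_lt (by simpa [Real.norm_eq_abs] using hI) ?_
  rw [abs_of_pos Real.pi_pos]
  have h1 : L * δ * (2 * Real.pi) ≤ 2 * Real.pi * (L + 1) * δ := by nlinarith [Real.pi_pos, hδ0, hL0]
  have h2 : 2 * Real.pi * (L + 1) * δ < ε := by
    rw [hδ, mul_div_assoc', div_lt_iff₀ hden]
    nlinarith [Real.pi_pos, hε, hL0]
  linarith

/-- **`circ` under locally uniform convergence of one slice.** -/
theorem tendsto_circ {w : ℕ → ℝ → EuclideanSpace ℝ (Fin 3) → EuclideanSpace ℝ (Fin 3)}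
    {W : ℝ → EuclideanSpace ℝ (Fin 3) → EuclideanSpace ℝ (Fin 3)} {t : ℝ}
    (hw : ∀ j, Continuous (w j t)) (hW : Continuous (W t))
    (h : TendstoLocallyUniformly (fun j => w j t) (W t) atTop) (r z : ℝ) :
    Tendsto (fun j => circ (w j) r z t) atTop (𝓝 (circ W r z t)) := by
  unfold circ
  refine tendsto_circleIntegral (F := fun j => w j t) hw hW h (Φ := fun θ a => ⟪a, eT θ⟫_ℝ * r)
    ((continuous_snd.inner (continuous_eT.comp continuous_fst)).mul continuous_const) (abs_nonneg r)
    (fun θ a b => ?_) r z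
  rw [← sub_mul, ← inner_sub_left, abs_mul]
  calc |⟪a - b, eT θ⟫_ℝ| * |r| ≤ ‖a - b‖ * ‖eT θ‖ * |r| :=
        mul_le_mul_of_nonneg_right (abs_real_inner_le_norm _ _) (abs_nonneg r)
    _ = |r| * ‖a - b‖ := by rw [norm_eT]; ring

/-- Locally uniform convergence of slice gradients gives locally uniform convergence of the curls
(`curl = curlCLM ∘ D`, `curlCLM` uniformly continuous). -/
theorem tendstoLocallyUniformly_curl {w : ℕ → ℝ → EuclideanSpace ℝ (Fin 3) → EuclideanSpace ℝ (Fin 3)}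
    {W : ℝ → EuclideanSpace ℝ (Fin 3) → EuclideanSpace ℝ (Fin 3)} {t : ℝ}
    (h : TendstoLocallyUniformly (fun j => fderiv ℝ (w j t)) (fderiv ℝ (W t)) atTop) :
    TendstoLocallyUniformly (fun j => curl (w j t)) (curl (W t)) atTop := by
  have hc := curlCLM.uniformContinuous.comp_tendstoLocallyUniformly h
  simpa [curl_eq_curlCLM_comp] using hc

/-- **`vortCirc` under locally uniform convergence of the curl of one slice.** -/
theorem tendsto_vortCirc {w : ℕ → ℝ → EuclideanSpace ℝ (Fin 3) → EuclideanSpace ℝ (Fin 3)}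
    {W : ℝ → EuclideanSpace ℝ (Fin 3) → EuclideanSpace ℝ (Fin 3)} {t : ℝ}
    (hw : ∀ j, Continuous (curl (w j t))) (hW : Continuous (curl (W t)))
    (h : TendstoLocallyUniformly (fun j => curl (w j t)) (curl (W t)) atTop) (r z : ℝ) :
    Tendsto (fun j => vortCirc (w j) r z t) atTop (𝓝 (vortCirc W r z t)) := by
  unfold vortCirc
  refine tendsto_circleIntegral (F := fun j => curl (w j t)) hw hW h (Φ := fun _ a => ⟪a, e3⟫_ℝ * r)
    ((continuous_snd.inner continuous_const).mul continuous_const) (abs_nonneg r) (fun θ a b => ?_) r z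
  rw [← sub_mul, ← inner_sub_left, abs_mul]
  have he3 : ‖e3‖ = 1 := by simp [e3]
  calc |⟪a - b, e3⟫_ℝ| * |r| ≤ ‖a - b‖ * ‖e3‖ * |r| :=
        mul_le_mul_of_nonneg_right (abs_real_inner_le_norm _ _) (abs_nonneg r)
    _ = |r| * ‖a - b‖ := by rw [he3]; ring

/-- **`tiltCirc` under locally uniform convergence of the curl of one slice.** -/
theorem tendsto_tiltCirc {w : ℕ → ℝ → EuclideanSpace ℝ (Fin 3) → EuclideanSpace ℝ (Fin 3)}
    {W : ℝ → EuclideanSpace ℝ (Fin 3) → EuclideanSpace ℝ (Fin 3)} {t : ℝ}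
    (hw : ∀ j, Continuous (curl (w j t))) (hW : Continuous (curl (W t)))
    (h : TendstoLocallyUniformly (fun j => curl (w j t)) (curl (W t)) atTop) (r z : ℝ) :
    Tendsto (fun j => tiltCirc (w j) r z t) atTop (𝓝 (tiltCirc W r z t)) := by
  unfold tiltCirc
  have he3 : ‖e3‖ = 1 := by simp [e3]
  refine tendsto_circleIntegral (F := fun j => curl (w j t)) hw hW h
    (Φ := fun _ a => ‖a - ⟪a, e3⟫_ℝ • e3‖ * r) ?_ (by positivity : (0 : ℝ) ≤ 2 * |r|) (fun θ a b => ?_) r z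
  · have h1 : Continuous fun p : ℝ × EuclideanSpace ℝ (Fin 3) => p.2 - ⟪p.2, e3⟫_ℝ • e3 := by fun_prop
    exact h1.norm.mul continuous_const
  · rw [← sub_mul, abs_mul]
    have hlin : (a - ⟪a, e3⟫_ℝ • e3) - (b - ⟪b, e3⟫_ℝ • e3) = (a - b) - ⟪a - b, e3⟫_ℝ • e3 := by
      rw [inner_sub_left, sub_smul]; abel
    have h1 : |‖a - ⟪a, e3⟫_ℝ • e3‖ - ‖b - ⟪b, e3⟫_ℝ • e3‖| ≤ ‖(a - b) - ⟪a - b, e3⟫_ℝ • e3‖ := by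
      rw [← hlin]; exact abs_norm_sub_norm_le _ _
    have h2 : ‖(a - b) - ⟪a - b, e3⟫_ℝ • e3‖ ≤ 2 * ‖a - b‖ := by
      refine (norm_sub_le _ _).trans ?_
      rw [norm_smul, Real.norm_eq_abs, he3, mul_one]
      have := abs_real_inner_le_norm (a - b) e3
      rw [he3, mul_one] at this
      linarith
    calc |‖a - ⟪a, e3⟫_ℝ • e3‖ - ‖b - ⟪b, e3⟫_ℝ • e3‖| * |r| ≤ 2 * ‖a - b‖ * |r| :=
          mul_le_mul_of_nonneg_right (h1.trans h2) (abs_nonneg r)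
      _ = 2 * |r| * ‖a - b‖ := by ring

/-! ### Passing the sign, the cone and the vanishing flux to the limit -/

/-- The sign `ω₃ ≥ 0` passes to pointwise limits of the curls. -/
theorem inner_curl_e3_nonneg_of_tendsto {w : ℕ → ℝ → EuclideanSpace ℝ (Fin 3) → EuclideanSpace ℝ (Fin 3)}
    {W : ℝ → EuclideanSpace ℝ (Fin 3) → EuclideanSpace ℝ (Fin 3)} {t : ℝ} {y : EuclideanSpace ℝ (Fin 3)}
    (h : Tendsto (fun j => curl (w j t) y) atTop (𝓝 (curl (W t) y)))
    (hsign : ∀ j, 0 ≤ ⟪curl (w j t) y, e3⟫_ℝ) : 0 ≤ ⟪curl (W t) y, e3⟫_ℝ :=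
  ge_of_tendsto' ((continuous_id.inner continuous_const).continuousAt.tendsto.comp h) hsign

/-- The circle cone passes to the limit of the circle functionals. -/
theorem tiltCirc_le_of_tendsto {w : ℕ → ℝ → EuclideanSpace ℝ (Fin 3) → EuclideanSpace ℝ (Fin 3)}
    {W : ℝ → EuclideanSpace ℝ (Fin 3) → EuclideanSpace ℝ (Fin 3)} {t r z K : ℝ}
    (hv : Tendsto (fun j => vortCirc (w j) r z t) atTop (𝓝 (vortCirc W r z t)))
    (ht : Tendsto (fun j => tiltCirc (w j) r z t) atTop (𝓝 (tiltCirc W r z t)))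
    (hcone : ∀ j, tiltCirc (w j) r z t ≤ K * vortCirc (w j) r z t) :
    tiltCirc W r z t ≤ K * vortCirc W r z t :=
  le_of_tendsto_of_tendsto' ht (hv.const_mul K) hcone

/-- Vanishing flux passes to the limit. -/
theorem circ_eq_zero_of_tendsto {w : ℕ → ℝ → EuclideanSpace ℝ (Fin 3) → EuclideanSpace ℝ (Fin 3)}
    {W : ℝ → EuclideanSpace ℝ (Fin 3) → EuclideanSpace ℝ (Fin 3)} {t r z : ℝ}
    (h : Tendsto (fun j => circ (w j) r z t) atTop (𝓝 (circ W r z t)))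
    (h0 : Tendsto (fun j => circ (w j) r z t) atTop (𝓝 0)) : circ W r z t = 0 :=
  tendsto_nhds_unique h h0

end Summit.NavierStokesRegularity.NavierStokesRegularity.Theorems.AveragedConeLiouville.CircleLimits

end
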